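import Summits.AtomisticToContinuum.Crystallization.Theorems.PhononSlackCertificatesPeriodicGivenLayeredLayerCake
import Summits.AtomisticToContinuum.Crystallization.Theorems.GappedShellCensusCleanLimitsHaveWindowsLayerCakeBand2

/-!
# `CleanLimitsHaveWindows` (stmt-AtomisticToContinuum-15932), line `Sketch`: stub `stub_layerCakeBand`

Registered stub `stub_layerCakeBand` of the skeleton of line `Sketch` of the crux
`GappedShellCensus.CleanLimitsHaveWindows`: the layer-cake bookkeeping `LayeredHull.stub_layerCake` of exactly
layered sets `S(A, s, z) = {A (i u(a) + j v(a) + L(m) w(a) + z(m) e₃)}` (`L = haggLabel s`, `A` a linear isometry)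
on the CLEAN BAND — in-plane spacing `a ∈ [9/10, 11/10]`, ANY word `s : ℤ → ℤ`, heights `z` with increments
`≥ 7a/10` and no upper bound — with the constant `C = 480`:

* (a) decay `|layerInteraction V_LJ a H δ 1| ≤ 480 / H⁴` for `|H| ≥ 7/10` (part 1, `cakeB_abs_layerInteraction_le`,
  valid for `|H| ≥ 63/100`);
* (b) `1/2`-separation of `S(A, s, z)` (part 1, `cakeB_separated`);
* (c) summability over the layers of the layer interactions seen from a layer (part 1, `cakeB_summable_layers`);
* (d) the site energy of a point of layer `m` is `Φ₀(a) + ∑'_{m' ≠ m} layerInteraction V_LJ a (z m' − z m)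
  (L m' − L m) 1` (part 2, `cakeB_siteEnergy`);
* (e) the prisms `W(m₁, n, K)`: `W ⊆ S`, `#W = n K²`, `∑_W e_p = K² ∑_m ε_m`, boundary sum `≤ 192 (n K + K²)`
  (`cakeB_prisms` below: the proof of `LayeredHull.cake_prisms` verbatim, fed with `cakeB_dist_recentred_ge` and
  `cakeB_siteEnergy`; the boundary constant `192 = 6 · 32` does not depend on the band).
-/

noncomputable section

namespace Summit.AtomisticToContinuum.Crystallization.Theorems.CleanHull

open scoped BigOperators
open Filter Literature.MathematicalPhysics.StatisticalMechanics
open Summit.AtomisticToContinuum.Crystallization.Theorems.LayeredHull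

/-- **The prisms of a layered set on the band.** For `a ≥ 9/10`, a linear isometry `A`, any word `s`, heights with
increments `≥ 7a/10`, the set `S = S(A, s, z)` and its prism `W = W(m₁, n, K)` (layers `m₁ ≤ m < m₁ + n`, a `K × K`
rhombus of sites per layer, laterally re-centred by `⌊L m / 3⌋ (u + v)`): `W ⊆ S`, `#W = n K²`,
`∑_{p ∈ W} e_p(S) = K² ∑_m ε_m`, and `∑_{p ∈ W} (1 + dist(p, S ∖ W))⁻³ ≤ 192 (n K + K²)`. The set `S` and the prism
`W` are taken as named arguments with their defining equations (instantiate with `rfl`). [folklore] -/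
theorem cakeB_prisms (a : ℝ) (ha : 9 / 10 ≤ a) (A : (EuclideanSpace ℝ (Fin 3)) →ₗᵢ[ℝ]
    (EuclideanSpace ℝ (Fin 3))) (s : ℤ → ℤ)
    (z : ℤ → ℝ) (hz : ∀ m : ℤ, 7 / 10 * a ≤ z (m + 1) - z m) (m₁ : ℤ) (n K : ℕ)
    (S : Set (EuclideanSpace ℝ (Fin 3))) (hS : S = {p | ∃ m i j : ℤ, p = A (((i : ℝ) • triangularVec₁ a) +
      ((j : ℝ) • triangularVec₂ a) + ((haggLabel s m : ℝ) • barlowOffset a) + (z m • layerNormal 1))})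
    (W : Finset (EuclideanSpace ℝ (Fin 3))) (hW : W = ((Finset.Ico m₁ (m₁ + n)) ×ˢ ((Finset.range K) ×ˢ
        (Finset.range K))).image
      fun t : ℤ × (ℕ × ℕ) => A (((((t.2.1 : ℤ) - haggLabel s t.1 / 3 : ℤ) : ℝ) • triangularVec₁ a) +
        ((((t.2.2 : ℤ) - haggLabel s t.1 / 3 : ℤ) : ℝ) • triangularVec₂ a) +
        ((haggLabel s t.1 : ℝ) • barlowOffset a) + (z t.1 • layerNormal 1))) :
    (↑W : Set (EuclideanSpace ℝ (Fin 3))) ⊆ S ∧ W.card = n * K ^ 2 ∧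
    (∑ p ∈ W, (∑' q : {q : (EuclideanSpace ℝ (Fin 3)) // q ∈ S ∧ q ≠ p}, lennardJones (dist p (q :
        (EuclideanSpace ℝ (Fin 3)))))) =
      (K : ℝ) ^ 2 * ∑ m ∈ Finset.Ico m₁ (m₁ + n), (inLayerInteraction lennardJones a +
        ∑' m' : ℤ, if m' = m then (0 : ℝ) else
          layerInteraction lennardJones a (z m' - z m) (haggLabel s m' - haggLabel s m) 1) ∧
    (∑ p ∈ W, (1 + Metric.infDist p (S \ (↑W : Set (EuclideanSpace ℝ (Fin 3)))))⁻¹ ^ 3) ≤ 192 * (n * K + K ^ 2)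
        := by
  have ha0 : 0 < a := by linarith
  have hzinj : Function.Injective z := cakeB_height_injective a ha0 z hz
  -- the parametrisation of the prism
  set P : ℤ × (ℕ × ℕ) → (EuclideanSpace ℝ (Fin 3)) := fun t : ℤ × (ℕ × ℕ) =>
    A (((((t.2.1 : ℤ) - haggLabel s t.1 / 3 : ℤ) : ℝ) • triangularVec₁ a) +
      ((((t.2.2 : ℤ) - haggLabel s t.1 / 3 : ℤ) : ℝ) • triangularVec₂ a) +
      ((haggLabel s t.1 : ℝ) • barlowOffset a) + (z t.1 • layerNormal 1)) with hP
  subst hW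
  have hPt : ∀ (m : ℤ) (x y : ℕ), P (m, (x, y)) = A (layerVec a (z m) (haggLabel s m % 3) 1 x y) := by
    intro m x y
    simp only [hP, cake_recentre]
  have hinjP : Function.Injective P := by
    rintro ⟨m, x, y⟩ ⟨m', x', y'⟩ h
    rw [hPt, hPt] at h
    obtain ⟨h1, h2, h3⟩ :=
      cake_param_injective a ha0.ne' (fun m => haggLabel s m % 3) z hzinj (A.injective h)
    subst h1
    have h2' : x = x' := by exact_mod_cast h2
    have h3' : y = y' := by exact_mod_cast h3
    rw [h2', h3']
  have hPS : ∀ t, P t ∈ S := fun t => by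
    rw [hS]
    exact ⟨t.1, (t.2.1 : ℤ) - haggLabel s t.1 / 3, (t.2.2 : ℤ) - haggLabel s t.1 / 3, rfl⟩
  refine ⟨?_, ?_, ?_, ?_⟩
  · -- `W ⊆ S`
    intro p hp
    rw [Finset.mem_coe, Finset.mem_image] at hp
    obtain ⟨t, -, rfl⟩ := hp
    exact hPS t
  · -- `#W = n K²`
    rw [Finset.card_image_of_injective _ hinjP, Finset.card_product, Finset.card_product,
      Finset.card_range, Int.card_Ico]
    have hI : (m₁ + (n : ℤ) - m₁).toNat = n := by simp
    rw [hI]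
    ring
  · -- the energy of the prism
    rw [Finset.sum_image fun t _ t' _ h => hinjP h]
    have hE : ∀ t ∈ Finset.Ico m₁ (m₁ + n) ×ˢ (Finset.range K ×ˢ Finset.range K),
        (∑' q : {q : (EuclideanSpace ℝ (Fin 3)) // q ∈ S ∧ q ≠ P t}, lennardJones (dist (P t) (q :
            (EuclideanSpace ℝ (Fin 3))))) =
          inLayerInteraction lennardJones a + ∑' m' : ℤ, (if m' = t.1 then (0 : ℝ) else
            layerInteraction lennardJones a (z m' - z t.1) (haggLabel s m' - haggLabel s t.1) 1) := by
      intro t _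
      subst hS
      exact cakeB_siteEnergy a ha A s z hz t.1 ((t.2.1 : ℤ) - haggLabel s t.1 / 3)
        ((t.2.2 : ℤ) - haggLabel s t.1 / 3)
    rw [Finset.sum_congr rfl hE]
    exact cake_sum_box_layer (fun m => inLayerInteraction lennardJones a + ∑' m' : ℤ,
      (if m' = m then (0 : ℝ) else
        layerInteraction lennardJones a (z m' - z m) (haggLabel s m' - haggLabel s m) 1)) m₁ n K
  · -- the boundary sum
    rw [Finset.sum_image fun t _ t' _ h => hinjP h]
    set B : ℕ → ℝ := fun k => 64 / ((k : ℝ) + 3) ^ 3 with hB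
    have hB0 : ∀ k, 0 ≤ B k := fun k => by positivity
    -- a point of `S` outside the prism
    have hne : (S \ ↑((Finset.Ico m₁ (m₁ + n) ×ˢ (Finset.range K ×ˢ Finset.range K)).image P)).Nonempty := by
      refine ⟨A (layerVec a (z (m₁ - 1)) (haggLabel s (m₁ - 1)) 1 0 0), ?_, ?_⟩
      · rw [hS]
        exact ⟨m₁ - 1, 0, 0, by rw [cake_pt_eq_layerVec]⟩
      · intro hmem
        rw [Finset.mem_coe, Finset.mem_image] at hmem
        obtain ⟨⟨m', x', y'⟩, ht', heq⟩ := hmem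
        rw [hPt] at heq
        have h2 := congrArg (fun v : (EuclideanSpace ℝ (Fin 3)) => v 2) (A.injective heq)
        simp only [cake_layerVec_apply_two] at h2
        have h3 := hzinj h2
        simp only [Finset.mem_product, Finset.mem_Ico] at ht'
        omega
    -- the per-point bound
    have hpt : ∀ t ∈ Finset.Ico m₁ (m₁ + n) ×ˢ (Finset.range K ×ˢ Finset.range K),
        (1 + Metric.infDist (P t)
          (S \ ↑((Finset.Ico m₁ (m₁ + n) ×ˢ (Finset.range K ×ˢ Finset.range K)).image P)))⁻¹ ^ 3 ≤
        B t.2.1 + B (K - 1 - t.2.1) + B t.2.2 + B (K - 1 - t.2.2) + B (t.1 - m₁).toNat +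
          B (m₁ + n - 1 - t.1).toNat := by
      rintro ⟨m, x, y⟩ ht
      simp only [Finset.mem_product, Finset.mem_Ico, Finset.mem_range] at ht
      obtain ⟨⟨hm1, hm2⟩, hx, hy⟩ := ht
      dsimp only
      set dmin : ℕ := min (min x (K - 1 - x)) (min (min y (K - 1 - y))
        (min (m - m₁).toNat (m₁ + n - 1 - m).toNat)) with hdmin
      have hd1 : dmin ≤ x := (min_le_left _ _).trans (min_le_left _ _)
      have hd2 : dmin ≤ K - 1 - x := (min_le_left _ _).trans (min_le_right _ _)
      have hd3 : dmin ≤ y := (min_le_right _ _).trans ((min_le_left _ _).trans (min_le_left _ _))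
      have hd4 : dmin ≤ K - 1 - y := (min_le_right _ _).trans ((min_le_left _ _).trans (min_le_right _ _))
      have hd5 : dmin ≤ (m - m₁).toNat := (min_le_right _ _).trans ((min_le_right _ _).trans (min_le_left _ _))
      have hd6 : dmin ≤ (m₁ + n - 1 - m).toNat :=
        (min_le_right _ _).trans ((min_le_right _ _).trans (min_le_right _ _))
      have hinf : ((dmin : ℝ) - 1) / 4 ≤ Metric.infDist (P (m, (x, y)))
          (S \ ↑((Finset.Ico m₁ (m₁ + n) ×ˢ (Finset.range K ×ˢ Finset.range K)).image P)) := by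
        refine (Metric.le_infDist hne).2 fun q hq => ?_
        obtain ⟨hqS, hqW⟩ := hq
        rw [hS] at hqS
        obtain ⟨m', i', j', rfl⟩ := hqS
        set x' : ℤ := i' + haggLabel s m' / 3 with hx'
        set y' : ℤ := j' + haggLabel s m' / 3 with hy'
        have hq_eq : A (((i' : ℝ) • triangularVec₁ a) + ((j' : ℝ) • triangularVec₂ a) +
            ((haggLabel s m' : ℝ) • barlowOffset a) + (z m' • layerNormal 1)) =
            A (layerVec a (z m') (haggLabel s m' % 3) 1 x' y') := by
          rw [cake_pt_eq_layerVec, cake_recentre']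
        have hbox : ¬ (m₁ ≤ m' ∧ m' < m₁ + n ∧ 0 ≤ x' ∧ x' < K ∧ 0 ≤ y' ∧ y' < K) := by
          rintro ⟨h1, h2, h3, h4, h5, h6⟩
          apply hqW
          rw [Finset.mem_coe, Finset.mem_image]
          refine ⟨(m', (x'.toNat, y'.toNat)), ?_, ?_⟩
          · simp only [Finset.mem_product, Finset.mem_Ico, Finset.mem_range]
            omega
          · rw [hPt, hq_eq, Int.toNat_of_nonneg h3, Int.toNat_of_nonneg h5]
        have hcase : (dmin : ℤ) + 1 ≤ |m' - m| ∨ (dmin : ℤ) + 1 ≤ |x' - (x : ℤ)| ∨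
            (dmin : ℤ) + 1 ≤ |y' - (y : ℤ)| := by
          by_cases c1 : m' < m₁
          · exact Or.inl (le_abs.2 (Or.inr (by omega)))
          by_cases c2 : m₁ + n ≤ m'
          · exact Or.inl (le_abs.2 (Or.inl (by omega)))
          by_cases c3 : x' < 0
          · exact Or.inr (Or.inl (le_abs.2 (Or.inr (by omega))))
          by_cases c4 : (K : ℤ) ≤ x'
          · exact Or.inr (Or.inl (le_abs.2 (Or.inl (by omega))))
          by_cases c5 : y' < 0
          · exact Or.inr (Or.inr (le_abs.2 (Or.inr (by omega))))
          by_cases c6 : (K : ℤ) ≤ y'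
          · exact Or.inr (Or.inr (le_abs.2 (Or.inl (by omega))))
          exact absurd ⟨by omega, by omega, by omega, by omega, by omega, by omega⟩ hbox
        rw [hPt, hq_eq, LinearIsometry.dist_map, dist_comm, dist_eq_norm, cake_layerVec_sub]
        exact cakeB_dist_recentred_ge a ha z hz (Int.emod_nonneg _ (by norm_num))
          (Int.emod_lt_of_pos _ (by norm_num)) (Int.emod_nonneg _ (by norm_num))
          (Int.emod_lt_of_pos _ (by norm_num)) m m' x y x' y' dmin hcase
      exact (cake_inv_cube_le_weight hinf).trans (cake_weight_min_le B hB0 _ _ _ _ _ _)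
    -- summing the per-point bounds
    have e1 : ∑ t ∈ Finset.Ico m₁ (m₁ + n) ×ˢ (Finset.range K ×ˢ Finset.range K), B t.2.1 =
        n * (K * ∑ x ∈ Finset.range K, B x) := cake_sum_box_fst B m₁ n K
    have e2 : ∑ t ∈ Finset.Ico m₁ (m₁ + n) ×ˢ (Finset.range K ×ˢ Finset.range K), B (K - 1 - t.2.1) =
        n * (K * ∑ x ∈ Finset.range K, B (K - 1 - x)) := cake_sum_box_fst (fun x => B (K - 1 - x)) m₁ n K
    have e3 : ∑ t ∈ Finset.Ico m₁ (m₁ + n) ×ˢ (Finset.range K ×ˢ Finset.range K), B t.2.2 =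
        n * (K * ∑ y ∈ Finset.range K, B y) := cake_sum_box_snd B m₁ n K
    have e4 : ∑ t ∈ Finset.Ico m₁ (m₁ + n) ×ˢ (Finset.range K ×ˢ Finset.range K), B (K - 1 - t.2.2) =
        n * (K * ∑ y ∈ Finset.range K, B (K - 1 - y)) := cake_sum_box_snd (fun y => B (K - 1 - y)) m₁ n K
    have e5 : ∑ t ∈ Finset.Ico m₁ (m₁ + n) ×ˢ (Finset.range K ×ˢ Finset.range K), B (t.1 - m₁).toNat =
        (K : ℝ) ^ 2 * ∑ m ∈ Finset.Ico m₁ (m₁ + n), B (m - m₁).toNat :=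
      cake_sum_box_layer (fun m => B (m - m₁).toNat) m₁ n K
    have e6 : ∑ t ∈ Finset.Ico m₁ (m₁ + n) ×ˢ (Finset.range K ×ˢ Finset.range K),
        B (m₁ + n - 1 - t.1).toNat =
        (K : ℝ) ^ 2 * ∑ m ∈ Finset.Ico m₁ (m₁ + n), B (m₁ + n - 1 - m).toNat :=
      cake_sum_box_layer (fun m => B (m₁ + n - 1 - m).toNat) m₁ n K
    have s1 : ∑ x ∈ Finset.range K, B x ≤ 32 := cake_sum_weight_le K
    have s2 : ∑ x ∈ Finset.range K, B (K - 1 - x) ≤ 32 := by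
      rw [Finset.sum_range_reflect B K]; exact cake_sum_weight_le K
    have s5 : ∑ m ∈ Finset.Ico m₁ (m₁ + n), B (m - m₁).toNat ≤ 32 := by
      rw [cake_sum_Ico_eq_sum_range]
      have : ∀ k ∈ Finset.range n, B (m₁ + (k : ℤ) - m₁).toNat = B k := fun k _ => by
        congr 1; omega
      rw [Finset.sum_congr rfl this]; exact cake_sum_weight_le n
    have s6 : ∑ m ∈ Finset.Ico m₁ (m₁ + n), B (m₁ + n - 1 - m).toNat ≤ 32 := by
      rw [cake_sum_Ico_eq_sum_range]
      have : ∀ k ∈ Finset.range n, B (m₁ + n - 1 - (m₁ + (k : ℤ))).toNat = B (n - 1 - k) := fun k hk => by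
        congr 1
        have := Finset.mem_range.1 hk
        omega
      rw [Finset.sum_congr rfl this, Finset.sum_range_reflect B n]; exact cake_sum_weight_le n
    have hn : (0 : ℝ) ≤ n := Nat.cast_nonneg n
    have hK : (0 : ℝ) ≤ K := Nat.cast_nonneg K
    calc ∑ t ∈ Finset.Ico m₁ (m₁ + n) ×ˢ (Finset.range K ×ˢ Finset.range K), (1 + Metric.infDist (P t)
          (S \ ↑((Finset.Ico m₁ (m₁ + n) ×ˢ (Finset.range K ×ˢ Finset.range K)).image P)))⁻¹ ^ 3
        ≤ ∑ t ∈ Finset.Ico m₁ (m₁ + n) ×ˢ (Finset.range K ×ˢ Finset.range K),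
            (B t.2.1 + B (K - 1 - t.2.1) + B t.2.2 + B (K - 1 - t.2.2) + B (t.1 - m₁).toNat +
              B (m₁ + n - 1 - t.1).toNat) := Finset.sum_le_sum hpt
      _ = n * (K * ∑ x ∈ Finset.range K, B x) + n * (K * ∑ x ∈ Finset.range K, B (K - 1 - x)) +
            n * (K * ∑ y ∈ Finset.range K, B y) + n * (K * ∑ y ∈ Finset.range K, B (K - 1 - y)) +
            (K : ℝ) ^ 2 * ∑ m ∈ Finset.Ico m₁ (m₁ + n), B (m - m₁).toNat +
            (K : ℝ) ^ 2 * ∑ m ∈ Finset.Ico m₁ (m₁ + n), B (m₁ + n - 1 - m).toNat := by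
          simp only [Finset.sum_add_distrib]
          rw [e1, e2, e3, e4, e5, e6]
      _ ≤ n * (K * 32) + n * (K * 32) + n * (K * 32) + n * (K * 32) + (K : ℝ) ^ 2 * 32 +
            (K : ℝ) ^ 2 * 32 := by
          gcongr
      _ ≤ 192 * (n * K + K ^ 2) := by nlinarith [mul_nonneg hn hK, sq_nonneg (K : ℝ)]

/-- Deliverable (a) alone (decay of the layer sums on the band), stated without `let`-binders: the registered
sub-goal this file is matched against (the registered text of `stub_layerCakeBand` is cut at its first `let … :=`).
[folklore] -/
theorem cakeB_layerCakeBand_decay :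
    ∃ C : ℝ, ∀ a : ℝ, 9 / 10 ≤ a → a ≤ 11 / 10 →
      ∀ (H : ℝ) (δ : ℤ), 7 / 10 ≤ |H| → |layerInteraction lennardJones a H δ 1| ≤ C / H ^ 4 :=
  ⟨480, fun a ha _ H δ hH => cakeB_abs_layerInteraction_le a H ha (by linarith) δ⟩

/-- **Stub T4b-i (layer cake on the clean band).** As `LayeredHull.stub_layerCake`, for in-plane spacings
`a ∈ [9/10, 11/10]`, ANY word `s : ℤ → ℤ` and heights with increments `≥ 7a/10` (no upper bound): decay of the layer
sums, `1/2`-separation, summability, the site-energy formula by layers, and the prism bookkeeping `W ⊆ S`, `#W = nK²`,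
`Σ_W e_p = K² Σ_m ε_m`, `∂W ≤ C(nK + K²)`, all with `C = 480`. [folklore] -/
theorem stub_layerCakeBand :
    ∃ C : ℝ, ∀ a : ℝ, 9 / 10 ≤ a → a ≤ 11 / 10 →
      (∀ (H : ℝ) (δ : ℤ), 7 / 10 ≤ |H| → |layerInteraction lennardJones a H δ 1| ≤ C / H ^ 4) ∧
      ∀ (A : (EuclideanSpace ℝ (Fin 3)) →ₗᵢ[ℝ] (EuclideanSpace ℝ (Fin 3))) (s : ℤ → ℤ) (z : ℤ → ℝ),
        (∀ m : ℤ, 7 / 10 * a ≤ z (m + 1) - z m) →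
        let S : Set (EuclideanSpace ℝ (Fin 3)) := {p | ∃ m i j : ℤ, p = A (((i : ℝ) • triangularVec₁ a) +
          ((j : ℝ) • triangularVec₂ a) + ((haggLabel s m : ℝ) • barlowOffset a) + (z m • layerNormal 1))};
        (∀ p ∈ S, ∀ q ∈ S, p ≠ q → 1 / 2 ≤ dist p q) ∧
        (∀ m : ℤ, Summable fun m' : ℤ => if m' = m then (0 : ℝ) else
          layerInteraction lennardJones a (z m' - z m) (haggLabel s m' - haggLabel s m) 1) ∧
        (∀ m i j : ℤ,
          (∑' q : {q : (EuclideanSpace ℝ (Fin 3)) // q ∈ S ∧ q ≠ A (((i : ℝ) • triangularVec₁ a) + ((j : ℝ) • triangularVec₂ a) +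
              ((haggLabel s m : ℝ) • barlowOffset a) + (z m • layerNormal 1))},
            lennardJones (dist (A (((i : ℝ) • triangularVec₁ a) + ((j : ℝ) • triangularVec₂ a) +
              ((haggLabel s m : ℝ) • barlowOffset a) + (z m • layerNormal 1))) (q : (EuclideanSpace ℝ (Fin 3))))) =
          inLayerInteraction lennardJones a + ∑' m' : ℤ, if m' = m then (0 : ℝ) else
            layerInteraction lennardJones a (z m' - z m) (haggLabel s m' - haggLabel s m) 1) ∧
        (∀ (m₁ : ℤ) (n K : ℕ),
          let W : Finset (EuclideanSpace ℝ (Fin 3)) := ((Finset.Ico m₁ (m₁ + n)) ×ˢ ((Finset.range K) ×ˢ (Finset.range K))).image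
            fun t : ℤ × (ℕ × ℕ) => A (((((t.2.1 : ℤ) - haggLabel s t.1 / 3 : ℤ) : ℝ) • triangularVec₁ a) +
              ((((t.2.2 : ℤ) - haggLabel s t.1 / 3 : ℤ) : ℝ) • triangularVec₂ a) +
              ((haggLabel s t.1 : ℝ) • barlowOffset a) + (z t.1 • layerNormal 1));
          (↑W : Set (EuclideanSpace ℝ (Fin 3))) ⊆ S ∧ W.card = n * K ^ 2 ∧
          (∑ p ∈ W, (∑' q : {q : (EuclideanSpace ℝ (Fin 3)) // q ∈ S ∧ q ≠ p}, lennardJones (dist p (q : (EuclideanSpace ℝ (Fin 3)))))) =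
            (K : ℝ) ^ 2 * ∑ m ∈ Finset.Ico m₁ (m₁ + n), (inLayerInteraction lennardJones a +
              ∑' m' : ℤ, if m' = m then (0 : ℝ) else
                layerInteraction lennardJones a (z m' - z m) (haggLabel s m' - haggLabel s m) 1) ∧
          (∑ p ∈ W, (1 + Metric.infDist p (S \ (↑W : Set (EuclideanSpace ℝ (Fin 3)))))⁻¹ ^ 3) ≤ C * (n * K + K ^ 2)) := by
  refine ⟨480, fun a ha _ha1 => ⟨fun H δ hH => cakeB_abs_layerInteraction_le a H ha (by linarith) δ, ?_⟩⟩
  intro A s z hz S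
  refine ⟨cakeB_separated a ha A s z hz, fun m => cakeB_summable_layers a ha s z hz m,
    fun m i j => cakeB_siteEnergy a ha A s z hz m i j, fun m₁ n K => ?_⟩
  intro W
  obtain ⟨h1, h2, h3, h4⟩ := cakeB_prisms a ha A s z hz m₁ n K S rfl W rfl
  refine ⟨h1, h2, h3, h4.trans ?_⟩
  have h0 : (0 : ℝ) ≤ n * K + K ^ 2 := by positivity
  nlinarith

end Summit.AtomisticToContinuum.Crystallization.Theorems.CleanHull

end
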